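import Summits.KontsevichZagierPeriods.KontsevichZagierPeriods.Theses.WZCosetWall
import Summits.KontsevichZagierPeriods.KontsevichZagierPeriods.Theses.TerasomaMultiplication
import Literature.NumberTheory.Transcendental.KZKernelConjectureForms

/-!
# `SeriesKernel` (stmt-KontsevichZagierPeriods-6872) — birth skeleton (BC3), line `birth`

Crux 0 (auto-crux, conjecture-grade) of route WZCosetWall: CONJECTURE 1 FOR THE CALCULUS KZ^Σ (four
moves + the dominated rational-geometric termwise-summation rule), in `R`-form — for every additive
subgroup `R ⊇ relations` of `FormalRep` closed under the Σ-rule, `ker eval ⊆ R`. This file registers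
the crux's birth skeleton: two named stubs and the kernel-checked composition `SeriesKernel_of`,
concluding the crux BY NAME.

THE CUT (sector factorisation through the Deligne–Koblitz–Ogus Γ-HODGE SECTOR — the route's own
"coset wall = Gauss multiplication" reading made into the seam). The route's thesis says that on the
hypergeometric sector the residue of (K) = SeriesKernel is exactly Carlson's constancy step, i.e.
Gauss multiplication / the Γ-sector (TriplicationThirdShift, Neg 0311/0312). So the kernel statement
is cut into "the Σ-enlarged calculus reaches the Γ-sector" and "Conjecture 1 modulo the Γ-sector":

  (stub 1) `stub_kernelModGammaSector` — the SHARED Γ-COMPLEMENT in KERNEL form: for every subgroup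
           `H ⊇ relations` holding the difference `[ρ] − [ρ']` of every Γ-Hodge pair (hypotheses
           VERBATIM those of `TerasomaMultiplication.CompleteModGammaSector`, item stmt-14233),
           `ker eval ⊆ H`. It is item 14233 transferred from the two-rational-representation form
           to the kernel form (`completeModGammaSector_to_stub₁` / `stub₁_to_twoRepForm` below,
           both PROVED: by `KZ.exists_integralRep_sub_holds`, `KZ.exists_isRational_equivalent_holds`
           and soundness), NOT re-filed: one proof of 14233 discharges it. GPC-strength residual.
  (stub 2) `stub_gammaPairsInSigmaClosed` — the WZ-SPECIFIC piece: every Σ-closed `R ⊇ relations`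
           (the Σ-closure hypothesis VERBATIM that of `SeriesKernel`) contains every Γ-Hodge pair
           difference: the summation rule breaks the coset wall. Implied by `GammaHodgeSector`
           (stmt-3742, `gammaHodgeSector_to_stub₂`) and by the crux itself
           (`seriesKernel_to_stub₂`: Γ-pairs have equal values), strictly weaker than 3742 by exactly
           the Σ-rule; its content beyond the four moves is BetaCancellation / the Yamamoto–Das gap
           pairs / Euler reflection (the open relators of the proved compiler
           `GammaHodgeFromRelators`, stmt-14947), for which termwise summation (Chowla–Selberg-type
           series, telescoping to the k → ∞ anchor) is the route's proposed lever.

COMPOSITION (`SeriesKernel_of : SeriesKernel`, stubs used BY NAME): given `R`, `relations ≤ R` and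
Σ-closure, stub 2 yields the pair hypothesis of stub 1 at `H := R`, and stub 1 gives `ker eval ⊆ R`.
No definition is introduced (every hypothesis is written out verbatim from the route files
`Theses/WZCosetWall.lean` rev 1 and `Theses/TerasomaMultiplication.lean`). Sorries: exactly the two
`stub_*`.

Disproof used: none on this item (`ledger crux ls stmt-KontsevichZagierPeriods-6872`: no workfiles
before this one). The sibling residual's adversary file `Cruxes/CompleteModGammaSector/Disproof.lean`
bears on stub 1 exactly as on 14233: `relations ≤ H` and value equality are load-bearing
(`…_false_without_relationsLe`, `…_false_without_valueEq`) — both kept; a kill of stub 1 is a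
disproof of the summit (`summit_false_of_not`).

References: Kontsevich–Zagier 2001 §1.2 (Conjecture 1); Huber–Müller-Stach 2017 Conj. 13.2.1;
Deligne 1982 (Hodge cycles) Thm 7.18; Koblitz–Ogus 1979; Das 2000; Ekhad–Zeilberger 1994 /
Zudilin 2008 §3 (the Carlson step); Guillera 2025 Thm 1.1; Andrews–Askey–Roy 1999 Thm 2.8.1.
-/

-- `Summit.KontsevichZagierPeriods.KontsevichZagierPeriods.…` is the tree's mandated layout (single-conjunct summit).
set_option linter.dupNamespace false

namespace Summit.KontsevichZagierPeriods.KontsevichZagierPeriods.Cruxes.SeriesKernel.Birth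

open scoped BigOperators
open Literature.NumberTheory.Transcendental

/-- **Stub 1 — Conjecture 1 modulo the Γ-sector, kernel form** (`KernelModGammaSector`).
For every subgroup `H` of the formal group with `relations ≤ H` which contains the difference
`[ρ] − [ρ']` of every Deligne–Koblitz–Ogus Γ-Hodge pair (hypotheses VERBATIM those of
`TerasomaMultiplication.CompleteModGammaSector`: cube representation of `Π B(x_j,y_j)` versus
`[unit 2k-ball × (0,1)^N', c·k!·Π(…)]`, Hodge-type condition via `Int.fract`, `c` real algebraic,
equal values), every formal combination `w` with `eval w = 0` lies in `H`.
Why plausibly true: implied by Conjecture 1 (`kzKernelConjecture_to_stub₁`); it IS item stmt-14233 in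
kernel form (`completeModGammaSector_to_stub₁`, `stub₁_to_twoRepForm`). Size: open-problem
(GPC-strength residual, shared with routes TerasomaMultiplication / MotivatedMoves / FermatIsogeny).
Leans on: nothing unproved. -/
theorem stub_kernelModGammaSector :
    ∀ H : AddSubgroup Literature.NumberTheory.Transcendental.KZ.FormalRep, Literature.NumberTheory.Transcendental.KZ.relations ≤ H → (∀ (N N' k : ℕ) (x y : Fin N → ℚ) (x' y' : Fin N' → ℚ) (c : ℝ), (∀ j, 0 < x j ∧ 0 < y j ∧ Int.fract (x j) ≠ 0 ∧ Int.fract (y j) ≠ 0) → (∀ l, 0 < x' l ∧ 0 < y' l ∧ Int.fract (x' l) ≠ 0 ∧ Int.fract (y' l) ≠ 0) → (∀ u : ℕ, 0 < u → (∀ j, Nat.Coprime u (x j).den ∧ Nat.Coprime u (y j).den) → (∀ l, Nat.Coprime u (x' l).den ∧ Nat.Coprime u (y' l).den) → ((∑ j, (Int.fract ((u : ℚ) * x j) + Int.fract ((u : ℚ) * y j) - Int.fract ((u : ℚ) * (x j + y j)))) - ∑ l, (Int.fract ((u : ℚ) * x' l) + Int.fract ((u : ℚ) * y' l) - Int.fract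 ((u : ℚ) * (x' l + y' l)))) = (k : ℚ)) → IsAlgebraic ℚ c → ∀ (ρ : Literature.NumberTheory.Transcendental.KZ.IntegralRep N) (ρ' : Literature.NumberTheory.Transcendental.KZ.IntegralRep (2 * k + N')), ρ.domain = {t | ∀ j, t j ∈ Set.Ioo (0:ℝ) 1} → Set.EqOn ρ.integrand (fun t => ∏ j, (t j) ^ ((x j : ℝ) - 1) * (1 - t j) ^ ((y j : ℝ) - 1)) ρ.domain → ρ'.domain = {z | (∑ i : Fin (2 * k), (z (Fin.castAdd N' i)) ^ 2) < 1 ∧ ∀ l : Fin N', z (Fin.natAdd (2 * k) l) ∈ Set.Ioo (0:ℝ) 1} → Set.EqOn ρ'.integrand (fun z => c * (k.factorial : ℝ) * ∏ l, (z (Fin.natAdd (2 * k) l)) ^ ((x' l : ℝ) - 1) * (1 - z (Fin.natAdd (2 * k) l)) ^ ((y' l : ℝ) - 1)) ρ'.domain → ρ.value = ρ'.value → Literature.NumberTheory.Transcendental.KZ.of ρ - Literature.NumberTheory.Transcendental.KZ.of ρ' ∈ H) → ∀ w : Literature.NumberTheory.Transcendental.KZ.FormalRep, Literature.NumberTheory.Transcendental.KZ.eval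 w = 0 → w ∈ H := by
  sorry

/-- **Stub 2 — the Σ-enlarged calculus reaches the Γ-sector** (`GammaPairsInSigmaClosed`).
For every subgroup `R` with `relations ≤ R` which is closed under DOMINATED RATIONAL-GEOMETRIC
TERMWISE SUMMATION (the hypothesis VERBATIM that of `WZCosetWall.SeriesKernel`: two families
`r_m = [σ, Σ_j f_j·C(m+j,j)·q^m]`, `s_m = [τ, Σ_j g_j·C(m+j,j)·q'^m]`, `|q|,|q'| < 1`, resummed
representations `rs`, `ss`, integrable dominating sums, `[r_m] − [s_m] ∈ R` for all `m` ⇒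
`[rs] − [ss] ∈ R`), the difference `[ρ] − [ρ']` of every Γ-Hodge pair (hypotheses VERBATIM those of
`TerasomaMultiplication.GammaHodgeSector`) lies in `R`: the coset walls (Gauss multiplication, Euler
reflection, the Yamamoto–Das gap pairs) are KZ^Σ-chains.
Why plausibly true: implied by `GammaHodgeSector` (stmt-3742, `gammaHodgeSector_to_stub₂`) and by
the crux (`seriesKernel_to_stub₂`); beyond the four moves its content is BetaCancellation
(stmt-13633), GapSectorBeyondTwelve (stmt-14858) and Euler reflection (stmt-3383) — the open inputs of
the PROVED relator compiler `GammaHodgeFromRelators` (stmt-14947) — now with the summation rule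
available (series proofs à la Chowla–Selberg; telescoping to the `k → ∞` anchor in place of Carlson).
Size: XL. Leans on (for a proof): MultiplicationAccessible (proved), DasGapTwelve (proved),
ResummedPrimitiveNL (stmt-6877, provable-now), BetaCancellation (open). -/
theorem stub_gammaPairsInSigmaClosed :
    ∀ R : AddSubgroup Literature.NumberTheory.Transcendental.KZ.FormalRep, Literature.NumberTheory.Transcendental.KZ.relations ≤ R → (∀ (n n' d d' : ℕ) (q : (Fin n → ℝ) → ℝ) (q' : (Fin n' → ℝ) → ℝ) (f : Fin d → (Fin n → ℝ) → ℝ) (g : Fin d' → (Fin n' → ℝ) → ℝ) (r : ℕ → Literature.NumberTheory.Transcendental.KZ.IntegralRep n) (s : ℕ → Literature.NumberTheory.Transcendental.KZ.IntegralRep n') (rs : Literature.NumberTheory.Transcendental.KZ.IntegralRep n) (ss : Literature.NumberTheory.Transcendental.KZ.IntegralRep n'), (∀ m, (r m).domain = rs.domain) → (∀ m, (s m).domain = ss.domain) → (∀ x ∈ rs.domain, |q x| < 1) → (∀ y ∈ ss.domain, |q' y| < 1) → (∀ m, ∀ x ∈ rs.domain, (r m).integrand x = ∑ j : Fin d, f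 j x * ((m + (j : ℕ)).choose j : ℝ) * q x ^ m) → (∀ m, ∀ y ∈ ss.domain, (s m).integrand y = ∑ j : Fin d', g j y * ((m + (j : ℕ)).choose j : ℝ) * q' y ^ m) → (∀ x ∈ rs.domain, rs.integrand x = ∑ j : Fin d, f j x / (1 - q x) ^ ((j : ℕ) + 1)) → (∀ y ∈ ss.domain, ss.integrand y = ∑ j : Fin d', g j y / (1 - q' y) ^ ((j : ℕ) + 1)) → MeasureTheory.IntegrableOn (fun x => ∑ j : Fin d, |f j x| / (1 - |q x|) ^ ((j : ℕ) + 1)) rs.domain → MeasureTheory.IntegrableOn (fun y => ∑ j : Fin d', |g j y| / (1 - |q' y|) ^ ((j : ℕ) + 1)) ss.domain → (∀ m, Literature.NumberTheory.Transcendental.KZ.of (r m) - Literature.NumberTheory.Transcendental.KZ.of (s m) ∈ R) → Literature.NumberTheory.Transcendental.KZ.of rs - Literature.NumberTheory.Transcendental.KZ.of ss ∈ R) → ∀ (N N' k : ℕ) (x y : Fin N → ℚ) (x' y' : Fin N' → ℚ) (c : ℝ), (∀ j, 0 < x j ∧ 0 < y j ∧ Int.fract (x j) ≠ 0 ∧ Int.fract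 (y j) ≠ 0) → (∀ l, 0 < x' l ∧ 0 < y' l ∧ Int.fract (x' l) ≠ 0 ∧ Int.fract (y' l) ≠ 0) → (∀ u : ℕ, 0 < u → (∀ j, Nat.Coprime u (x j).den ∧ Nat.Coprime u (y j).den) → (∀ l, Nat.Coprime u (x' l).den ∧ Nat.Coprime u (y' l).den) → ((∑ j, (Int.fract ((u : ℚ) * x j) + Int.fract ((u : ℚ) * y j) - Int.fract ((u : ℚ) * (x j + y j)))) - ∑ l, (Int.fract ((u : ℚ) * x' l) + Int.fract ((u : ℚ) * y' l) - Int.fract ((u : ℚ) * (x' l + y' l)))) = (k : ℚ)) → IsAlgebraic ℚ c → ∀ (ρ : Literature.NumberTheory.Transcendental.KZ.IntegralRep N) (ρ' : Literature.NumberTheory.Transcendental.KZ.IntegralRep (2 * k + N')), ρ.domain = {t | ∀ j, t j ∈ Set.Ioo (0:ℝ) 1} → Set.EqOn ρ.integrand (fun t => ∏ j, (t j) ^ ((x j : ℝ) - 1) * (1 - t j) ^ ((y j : ℝ) - 1)) ρ.domain → ρ'.domain = {z | (∑ i : Fin (2 * k), (z (Fin.castAdd N' i)) ^ 2) < 1 ∧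 ∀ l : Fin N', z (Fin.natAdd (2 * k) l) ∈ Set.Ioo (0:ℝ) 1} → Set.EqOn ρ'.integrand (fun z => c * (k.factorial : ℝ) * ∏ l, (z (Fin.natAdd (2 * k) l)) ^ ((x' l : ℝ) - 1) * (1 - z (Fin.natAdd (2 * k) l)) ^ ((y' l : ℝ) - 1)) ρ'.domain → ρ.value = ρ'.value → Literature.NumberTheory.Transcendental.KZ.of ρ - Literature.NumberTheory.Transcendental.KZ.of ρ' ∈ R := by
  sorry

/-- **Composition** — the crux BY NAME from the two stubs (used by name, the registry's shape): for
`R ⊇ relations` closed under the Σ-rule, `stub_gammaPairsInSigmaClosed` discharges the Γ-pair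
hypothesis of `stub_kernelModGammaSector` at `H := R`, which then gives `ker eval ⊆ R`. No sorry
here: the only sorries of the file are the two `stub_*`.
[Kontsevich–Zagier 2001, §1.2 Conjecture 1; Deligne 1982, Thm 7.18] -/
theorem SeriesKernel_of :
    Summit.KontsevichZagierPeriods.KontsevichZagierPeriods.Theses.WZCosetWall.SeriesKernel := by
  intro R hR hsum w hw
  exact stub_kernelModGammaSector R hR (stub_gammaPairsInSigmaClosed R hR hsum) w hw

/-! ### Bridges to the existing items (dedup record; sorry-free, stated over HYPOTHESES, never over
the sorried stubs) -/

/-- **Item stmt-14233 ⇒ stub 1**: the two-rational-representation form `CompleteModGammaSector` of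
route TerasomaMultiplication gives the kernel form relative to every admissible `H` — every formal
combination is `≡ [r] − [r']` modulo moves (`KZ.exists_integralRep_sub_holds`), algebraic integrands
reduce to rational ones (`KZ.exists_isRational_equivalent_holds`), and soundness
(`KZ.relations_le_ker_eval_holds`, `KZ.Equivalent.value_eq_holds`) transports the value equality.
[Kontsevich–Zagier 2001, §1.1 remark after the Definition, §1.2; Huber–Müller-Stach 2017, Conj. 13.2.1] -/
theorem completeModGammaSector_to_stub₁
    (hC : Summit.KontsevichZagierPeriods.KontsevichZagierPeriods.Theses.TerasomaMultiplication.CompleteModGammaSector) :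
    ∀ H : AddSubgroup Literature.NumberTheory.Transcendental.KZ.FormalRep, Literature.NumberTheory.Transcendental.KZ.relations ≤ H → (∀ (N N' k : ℕ) (x y : Fin N → ℚ) (x' y' : Fin N' → ℚ) (c : ℝ), (∀ j, 0 < x j ∧ 0 < y j ∧ Int.fract (x j) ≠ 0 ∧ Int.fract (y j) ≠ 0) → (∀ l, 0 < x' l ∧ 0 < y' l ∧ Int.fract (x' l) ≠ 0 ∧ Int.fract (y' l) ≠ 0) → (∀ u : ℕ, 0 < u → (∀ j, Nat.Coprime u (x j).den ∧ Nat.Coprime u (y j).den) → (∀ l, Nat.Coprime u (x' l).den ∧ Nat.Coprime u (y' l).den) → ((∑ j, (Int.fract ((u : ℚ) * x j) + Int.fract ((u : ℚ) * y j) - Int.fract ((u : ℚ) * (x j + y j)))) - ∑ l, (Int.fract ((u : ℚ) * x' l) + Int.fract ((u : ℚ) * y' l) - Int.fract ((u : ℚ) * (x' l + y' l)))) = (k : ℚ)) → IsAlgebraic ℚ c → ∀ (ρ : Literature.NumberTheory.Transcendental.KZ.IntegralRep N) (ρ' : Literature.NumberTheory.Transcendental.KZ.IntegralRep (2 * k +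 N')), ρ.domain = {t | ∀ j, t j ∈ Set.Ioo (0:ℝ) 1} → Set.EqOn ρ.integrand (fun t => ∏ j, (t j) ^ ((x j : ℝ) - 1) * (1 - t j) ^ ((y j : ℝ) - 1)) ρ.domain → ρ'.domain = {z | (∑ i : Fin (2 * k), (z (Fin.castAdd N' i)) ^ 2) < 1 ∧ ∀ l : Fin N', z (Fin.natAdd (2 * k) l) ∈ Set.Ioo (0:ℝ) 1} → Set.EqOn ρ'.integrand (fun z => c * (k.factorial : ℝ) * ∏ l, (z (Fin.natAdd (2 * k) l)) ^ ((x' l : ℝ) - 1) * (1 - z (Fin.natAdd (2 * k) l)) ^ ((y' l : ℝ) - 1)) ρ'.domain → ρ.value = ρ'.value → Literature.NumberTheory.Transcendental.KZ.of ρ - Literature.NumberTheory.Transcendental.KZ.of ρ' ∈ H) → ∀ w : Literature.NumberTheory.Transcendental.KZ.FormalRep, Literature.NumberTheory.Transcendental.KZ.eval w = 0 → w ∈ H := by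
  intro H hH hP w hw
  obtain ⟨n, m, r, r', hrel⟩ := KZ.exists_integralRep_sub_holds w
  obtain ⟨N, ρ, hρ, hrρ⟩ := KZ.exists_isRational_equivalent_holds r
  obtain ⟨N', ρ', hρ', hrρ'⟩ := KZ.exists_isRational_equivalent_holds r'
  have hker : KZ.eval (w - (KZ.of r - KZ.of r')) = 0 := KZ.relations_le_ker_eval_holds hrel
  rw [map_sub, hw, zero_sub, neg_eq_zero, KZ.eval_of_sub_of, sub_eq_zero] at hker
  have hv : ρ.value = ρ'.value := by
    rw [← KZ.Equivalent.value_eq_holds hrρ, ← KZ.Equivalent.value_eq_holds hrρ', hker]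
  have h₁ : KZ.of ρ - KZ.of ρ' ∈ H := hC H hH hP ρ ρ' hρ hρ' hv
  have h₂ : KZ.of r - KZ.of ρ ∈ H := hH hrρ
  have h₃ : KZ.of r' - KZ.of ρ' ∈ H := hH hrρ'
  have h₄ : w - (KZ.of r - KZ.of r') ∈ H := hH hrel
  have key : w = (w - (KZ.of r - KZ.of r')) +
      ((KZ.of r - KZ.of ρ) + (KZ.of ρ - KZ.of ρ') - (KZ.of r' - KZ.of ρ')) := by abel
  rw [key]
  exact H.add_mem h₄ (H.sub_mem (H.add_mem h₂ h₁) h₃)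

/-- **Stub 1 ⇒ item stmt-14233** (its body verbatim: the two-rational-representation form relative
to `H`): apply the kernel form to `w := [r] − [r']`, whose `eval` vanishes by the value equality.
Together with `completeModGammaSector_to_stub₁`: stub 1 ⟺ `CompleteModGammaSector`.
[Kontsevich–Zagier 2001, §1.2; Huber–Müller-Stach 2017, Conj. 13.2.1] -/
theorem stub₁_to_twoRepForm
    (h₁ : ∀ H : AddSubgroup Literature.NumberTheory.Transcendental.KZ.FormalRep, Literature.NumberTheory.Transcendental.KZ.relations ≤ H → (∀ (N N' k : ℕ) (x y : Fin N → ℚ) (x' y' : Fin N' → ℚ) (c : ℝ), (∀ j, 0 < x j ∧ 0 < y j ∧ Int.fract (x j) ≠ 0 ∧ Int.fract (y j) ≠ 0) → (∀ l, 0 < x' l ∧ 0 < y' l ∧ Int.fract (x' l) ≠ 0 ∧ Int.fract (y' l) ≠ 0) → (∀ u : ℕ, 0 < u → (∀ j, Nat.Coprime u (x j).den ∧ Nat.Coprime u (y j).den) → (∀ l, Nat.Coprime u (x' l).den ∧ Nat.Coprime u (y' l).den) → ((∑ j, (Int.fract ((u : ℚ) * x j) + Int.fract ((u : ℚ) * y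 j) - Int.fract ((u : ℚ) * (x j + y j)))) - ∑ l, (Int.fract ((u : ℚ) * x' l) + Int.fract ((u : ℚ) * y' l) - Int.fract ((u : ℚ) * (x' l + y' l)))) = (k : ℚ)) → IsAlgebraic ℚ c → ∀ (ρ : Literature.NumberTheory.Transcendental.KZ.IntegralRep N) (ρ' : Literature.NumberTheory.Transcendental.KZ.IntegralRep (2 * k + N')), ρ.domain = {t | ∀ j, t j ∈ Set.Ioo (0:ℝ) 1} → Set.EqOn ρ.integrand (fun t => ∏ j, (t j) ^ ((x j : ℝ) - 1) * (1 - t j) ^ ((y j : ℝ) - 1)) ρ.domain → ρ'.domain = {z | (∑ i : Fin (2 * k), (z (Fin.castAdd N' i)) ^ 2) < 1 ∧ ∀ l : Fin N', z (Fin.natAdd (2 * k) l) ∈ Set.Ioo (0:ℝ) 1} → Set.EqOn ρ'.integrand (fun z => c * (k.factorial : ℝ) * ∏ l, (z (Fin.natAdd (2 * k) l)) ^ ((x' l : ℝ) - 1) * (1 - z (Fin.natAdd (2 * k) l)) ^ ((y' l : ℝ) - 1)) ρ'.domain → ρ.value = ρ'.value → Literature.NumberTheory.Transcendental.KZ.of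 ρ - Literature.NumberTheory.Transcendental.KZ.of ρ' ∈ H) → ∀ w : Literature.NumberTheory.Transcendental.KZ.FormalRep, Literature.NumberTheory.Transcendental.KZ.eval w = 0 → w ∈ H) :
    ∀ H : AddSubgroup Literature.NumberTheory.Transcendental.KZ.FormalRep, Literature.NumberTheory.Transcendental.KZ.relations ≤ H → (∀ (N N' k : ℕ) (x y : Fin N → ℚ) (x' y' : Fin N' → ℚ) (c : ℝ), (∀ j, 0 < x j ∧ 0 < y j ∧ Int.fract (x j) ≠ 0 ∧ Int.fract (y j) ≠ 0) → (∀ l, 0 < x' l ∧ 0 < y' l ∧ Int.fract (x' l) ≠ 0 ∧ Int.fract (y' l) ≠ 0) → (∀ u : ℕ, 0 < u → (∀ j, Nat.Coprime u (x j).den ∧ Nat.Coprime u (y j).den) → (∀ l, Nat.Coprime u (x' l).den ∧ Nat.Coprime u (y' l).den) → ((∑ j, (Int.fract ((u : ℚ) * x j) + Int.fract ((u : ℚ) * y j) - Int.fract ((u : ℚ) * (x j + y j)))) - ∑ l, (Int.fract ((u : ℚ) * x' l) + Int.fract ((u : ℚ) * y' l) - Int.fract ((u : ℚ) * (x' l +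 y' l)))) = (k : ℚ)) → IsAlgebraic ℚ c → ∀ (ρ : Literature.NumberTheory.Transcendental.KZ.IntegralRep N) (ρ' : Literature.NumberTheory.Transcendental.KZ.IntegralRep (2 * k + N')), ρ.domain = {t | ∀ j, t j ∈ Set.Ioo (0:ℝ) 1} → Set.EqOn ρ.integrand (fun t => ∏ j, (t j) ^ ((x j : ℝ) - 1) * (1 - t j) ^ ((y j : ℝ) - 1)) ρ.domain → ρ'.domain = {z | (∑ i : Fin (2 * k), (z (Fin.castAdd N' i)) ^ 2) < 1 ∧ ∀ l : Fin N', z (Fin.natAdd (2 * k) l) ∈ Set.Ioo (0:ℝ) 1} → Set.EqOn ρ'.integrand (fun z => c * (k.factorial : ℝ) * ∏ l, (z (Fin.natAdd (2 * k) l)) ^ ((x' l : ℝ) - 1) * (1 - z (Fin.natAdd (2 * k) l)) ^ ((y' l : ℝ) - 1)) ρ'.domain → ρ.value = ρ'.value → Literature.NumberTheory.Transcendental.KZ.of ρ - Literature.NumberTheory.Transcendental.KZ.of ρ' ∈ H) → ∀ ⦃n m : ℕ⦄ (r : Literature.NumberTheory.Transcendental.KZ.IntegralRep n) (r' : Literature.NumberTheory.Transcendental.KZ.IntegralRep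 m), r.IsRational → r'.IsRational → r.value = r'.value → Literature.NumberTheory.Transcendental.KZ.of r - Literature.NumberTheory.Transcendental.KZ.of r' ∈ H := by
  intro H hH hP n m r r' _ _ hv
  exact h₁ H hH hP _ (by rw [KZ.eval_of_sub_of, hv, sub_self])

/-- **Conjecture 1 (kernel form) ⇒ stub 1**: `relations ≤ H`. Stub 1 is summit-implied, never
stronger than the summit. [Kontsevich–Zagier 2001, §1.2 Conjecture 1] -/
theorem kzKernelConjecture_to_stub₁ (hK : Literature.NumberTheory.Transcendental.KZKernelConjecture) :
    ∀ H : AddSubgroup Literature.NumberTheory.Transcendental.KZ.FormalRep, Literature.NumberTheory.Transcendental.KZ.relations ≤ H → (∀ (N N' k : ℕ) (x y : Fin N → ℚ) (x' y' : Fin N' → ℚ) (c : ℝ), (∀ j, 0 < x j ∧ 0 < y j ∧ Int.fract (x j) ≠ 0 ∧ Int.fract (y j) ≠ 0) → (∀ l, 0 < x' l ∧ 0 < y' l ∧ Int.fract (x' l) ≠ 0 ∧ Int.fract (y' l) ≠ 0) → (∀ u : ℕ, 0 < u → (∀ j, Nat.Coprime u (x j).den ∧ Nat.Coprime u (y j).den)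 → (∀ l, Nat.Coprime u (x' l).den ∧ Nat.Coprime u (y' l).den) → ((∑ j, (Int.fract ((u : ℚ) * x j) + Int.fract ((u : ℚ) * y j) - Int.fract ((u : ℚ) * (x j + y j)))) - ∑ l, (Int.fract ((u : ℚ) * x' l) + Int.fract ((u : ℚ) * y' l) - Int.fract ((u : ℚ) * (x' l + y' l)))) = (k : ℚ)) → IsAlgebraic ℚ c → ∀ (ρ : Literature.NumberTheory.Transcendental.KZ.IntegralRep N) (ρ' : Literature.NumberTheory.Transcendental.KZ.IntegralRep (2 * k + N')), ρ.domain = {t | ∀ j, t j ∈ Set.Ioo (0:ℝ) 1} → Set.EqOn ρ.integrand (fun t => ∏ j, (t j) ^ ((x j : ℝ) - 1) * (1 - t j) ^ ((y j : ℝ) - 1)) ρ.domain → ρ'.domain = {z | (∑ i : Fin (2 * k), (z (Fin.castAdd N' i)) ^ 2) < 1 ∧ ∀ l : Fin N', z (Fin.natAdd (2 * k) l) ∈ Set.Ioo (0:ℝ) 1} → Set.EqOn ρ'.integrand (fun z => c * (k.factorial : ℝ) * ∏ l, (z (Fin.natAdd (2 * k) l)) ^ ((x' l : ℝ) - 1)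 * (1 - z (Fin.natAdd (2 * k) l)) ^ ((y' l : ℝ) - 1)) ρ'.domain → ρ.value = ρ'.value → Literature.NumberTheory.Transcendental.KZ.of ρ - Literature.NumberTheory.Transcendental.KZ.of ρ' ∈ H) → ∀ w : Literature.NumberTheory.Transcendental.KZ.FormalRep, Literature.NumberTheory.Transcendental.KZ.eval w = 0 → w ∈ H :=
  fun _ hH _ w hw => hH (hK w hw)

/-- **Item stmt-3742 ⇒ stub 2**: the Γ-Hodge sector crux `GammaHodgeSector` (every Γ-Hodge pair is
KZ-equivalent outright, four moves) implies membership in every `R ⊇ relations`, the Σ-closure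
being unused — stub 2 is the strictly weaker KZ^Σ version. [Deligne 1982, Thm 7.18;
Kontsevich–Zagier 2001, §1.2] -/
theorem gammaHodgeSector_to_stub₂
    (hG : Summit.KontsevichZagierPeriods.KontsevichZagierPeriods.Theses.TerasomaMultiplication.GammaHodgeSector) :
    ∀ R : AddSubgroup Literature.NumberTheory.Transcendental.KZ.FormalRep, Literature.NumberTheory.Transcendental.KZ.relations ≤ R → (∀ (n n' d d' : ℕ) (q : (Fin n → ℝ) → ℝ) (q' : (Fin n' → ℝ) → ℝ) (f : Fin d → (Fin n → ℝ) → ℝ) (g : Fin d' → (Fin n' → ℝ) → ℝ) (r : ℕ → Literature.NumberTheory.Transcendental.KZ.IntegralRep n) (s : ℕ → Literature.NumberTheory.Transcendental.KZ.IntegralRep n') (rs : Literature.NumberTheory.Transcendental.KZ.IntegralRep n) (ss : Literature.NumberTheory.Transcendental.KZ.IntegralRep n'), (∀ m, (r m).domain = rs.domain) → (∀ m, (s m).domain = ss.domain) → (∀ x ∈ rs.domain, |q x| < 1) → (∀ y ∈ ss.domain, |q' y| < 1) → (∀ m, ∀ x ∈ rs.domain, (r m).integrand x = ∑ j : Fin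 d, f j x * ((m + (j : ℕ)).choose j : ℝ) * q x ^ m) → (∀ m, ∀ y ∈ ss.domain, (s m).integrand y = ∑ j : Fin d', g j y * ((m + (j : ℕ)).choose j : ℝ) * q' y ^ m) → (∀ x ∈ rs.domain, rs.integrand x = ∑ j : Fin d, f j x / (1 - q x) ^ ((j : ℕ) + 1)) → (∀ y ∈ ss.domain, ss.integrand y = ∑ j : Fin d', g j y / (1 - q' y) ^ ((j : ℕ) + 1)) → MeasureTheory.IntegrableOn (fun x => ∑ j : Fin d, |f j x| / (1 - |q x|) ^ ((j : ℕ) + 1)) rs.domain → MeasureTheory.IntegrableOn (fun y => ∑ j : Fin d', |g j y| / (1 - |q' y|) ^ ((j : ℕ) + 1)) ss.domain → (∀ m, Literature.NumberTheory.Transcendental.KZ.of (r m) - Literature.NumberTheory.Transcendental.KZ.of (s m) ∈ R) → Literature.NumberTheory.Transcendental.KZ.of rs - Literature.NumberTheory.Transcendental.KZ.of ss ∈ R) → ∀ (N N' k : ℕ) (x y : Fin N → ℚ) (x' y' : Fin N' → ℚ) (c : ℝ), (∀ j, 0 < x j ∧ 0 < y j ∧ Int.fract (x j) ≠ 0 ∧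 Int.fract (y j) ≠ 0) → (∀ l, 0 < x' l ∧ 0 < y' l ∧ Int.fract (x' l) ≠ 0 ∧ Int.fract (y' l) ≠ 0) → (∀ u : ℕ, 0 < u → (∀ j, Nat.Coprime u (x j).den ∧ Nat.Coprime u (y j).den) → (∀ l, Nat.Coprime u (x' l).den ∧ Nat.Coprime u (y' l).den) → ((∑ j, (Int.fract ((u : ℚ) * x j) + Int.fract ((u : ℚ) * y j) - Int.fract ((u : ℚ) * (x j + y j)))) - ∑ l, (Int.fract ((u : ℚ) * x' l) + Int.fract ((u : ℚ) * y' l) - Int.fract ((u : ℚ) * (x' l + y' l)))) = (k : ℚ)) → IsAlgebraic ℚ c → ∀ (ρ : Literature.NumberTheory.Transcendental.KZ.IntegralRep N) (ρ' : Literature.NumberTheory.Transcendental.KZ.IntegralRep (2 * k + N')), ρ.domain = {t | ∀ j, t j ∈ Set.Ioo (0:ℝ) 1} → Set.EqOn ρ.integrand (fun t => ∏ j, (t j) ^ ((x j : ℝ) - 1) * (1 - t j) ^ ((y j : ℝ) - 1)) ρ.domain → ρ'.domain = {z | (∑ i : Fin (2 * k), (z (Fin.castAdd N' i)) ^ 2)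 < 1 ∧ ∀ l : Fin N', z (Fin.natAdd (2 * k) l) ∈ Set.Ioo (0:ℝ) 1} → Set.EqOn ρ'.integrand (fun z => c * (k.factorial : ℝ) * ∏ l, (z (Fin.natAdd (2 * k) l)) ^ ((x' l : ℝ) - 1) * (1 - z (Fin.natAdd (2 * k) l)) ^ ((y' l : ℝ) - 1)) ρ'.domain → ρ.value = ρ'.value → Literature.NumberTheory.Transcendental.KZ.of ρ - Literature.NumberTheory.Transcendental.KZ.of ρ' ∈ R := by
  intro R hR _ N N' k x y x' y' c hx hx' hu hc ρ ρ' hd hi hd' hi' hval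
  exact hR (hG N N' k x y x' y' c hx hx' hu hc ρ ρ' hd hi hd' hi' hval)

/-- **The crux ⇒ stub 2** (stub 2 is a CONSEQUENCE of `SeriesKernel`, used toward it in
`SeriesKernel_of`): a Γ-Hodge pair has equal values, so `[ρ] − [ρ']` lies in `ker eval`, hence in
every Σ-closed `R ⊇ relations` by the crux. [Kontsevich–Zagier 2001, §1.2 Conjecture 1] -/
theorem seriesKernel_to_stub₂
    (hK : Summit.KontsevichZagierPeriods.KontsevichZagierPeriods.Theses.WZCosetWall.SeriesKernel) :
    ∀ R : AddSubgroup Literature.NumberTheory.Transcendental.KZ.FormalRep, Literature.NumberTheory.Transcendental.KZ.relations ≤ R → (∀ (n n' d d' : ℕ) (q : (Fin n → ℝ) → ℝ) (q' : (Fin n' → ℝ) → ℝ) (f : Fin d → (Fin n → ℝ) → ℝ) (g : Fin d' → (Fin n' → ℝ) → ℝ) (r : ℕ → Literature.NumberTheory.Transcendental.KZ.IntegralRep n) (s : ℕ → Literature.NumberTheory.Transcendental.KZ.IntegralRep n') (rs : Literature.NumberTheory.Transcendental.KZ.IntegralRep n) (ss : Literature.NumberTheory.Transcendental.KZ.IntegralRep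 n'), (∀ m, (r m).domain = rs.domain) → (∀ m, (s m).domain = ss.domain) → (∀ x ∈ rs.domain, |q x| < 1) → (∀ y ∈ ss.domain, |q' y| < 1) → (∀ m, ∀ x ∈ rs.domain, (r m).integrand x = ∑ j : Fin d, f j x * ((m + (j : ℕ)).choose j : ℝ) * q x ^ m) → (∀ m, ∀ y ∈ ss.domain, (s m).integrand y = ∑ j : Fin d', g j y * ((m + (j : ℕ)).choose j : ℝ) * q' y ^ m) → (∀ x ∈ rs.domain, rs.integrand x = ∑ j : Fin d, f j x / (1 - q x) ^ ((j : ℕ) + 1)) → (∀ y ∈ ss.domain, ss.integrand y = ∑ j : Fin d', g j y / (1 - q' y) ^ ((j : ℕ) + 1)) → MeasureTheory.IntegrableOn (fun x => ∑ j : Fin d, |f j x| / (1 - |q x|) ^ ((j : ℕ) + 1)) rs.domain → MeasureTheory.IntegrableOn (fun y => ∑ j : Fin d', |g j y| / (1 - |q' y|) ^ ((j : ℕ) + 1)) ss.domain → (∀ m, Literature.NumberTheory.Transcendental.KZ.of (r m) - Literature.NumberTheory.Transcendental.KZ.of (s m) ∈ R) → Literature.NumberTheory.Transcendental.KZ.of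 rs - Literature.NumberTheory.Transcendental.KZ.of ss ∈ R) → ∀ (N N' k : ℕ) (x y : Fin N → ℚ) (x' y' : Fin N' → ℚ) (c : ℝ), (∀ j, 0 < x j ∧ 0 < y j ∧ Int.fract (x j) ≠ 0 ∧ Int.fract (y j) ≠ 0) → (∀ l, 0 < x' l ∧ 0 < y' l ∧ Int.fract (x' l) ≠ 0 ∧ Int.fract (y' l) ≠ 0) → (∀ u : ℕ, 0 < u → (∀ j, Nat.Coprime u (x j).den ∧ Nat.Coprime u (y j).den) → (∀ l, Nat.Coprime u (x' l).den ∧ Nat.Coprime u (y' l).den) → ((∑ j, (Int.fract ((u : ℚ) * x j) + Int.fract ((u : ℚ) * y j) - Int.fract ((u : ℚ) * (x j + y j)))) - ∑ l, (Int.fract ((u : ℚ) * x' l) + Int.fract ((u : ℚ) * y' l) - Int.fract ((u : ℚ) * (x' l + y' l)))) = (k : ℚ)) → IsAlgebraic ℚ c → ∀ (ρ : Literature.NumberTheory.Transcendental.KZ.IntegralRep N) (ρ' : Literature.NumberTheory.Transcendental.KZ.IntegralRep (2 * k + N')), ρ.domain = {t | ∀ j, t j ∈ Set.Ioo (0:ℝ)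 1} → Set.EqOn ρ.integrand (fun t => ∏ j, (t j) ^ ((x j : ℝ) - 1) * (1 - t j) ^ ((y j : ℝ) - 1)) ρ.domain → ρ'.domain = {z | (∑ i : Fin (2 * k), (z (Fin.castAdd N' i)) ^ 2) < 1 ∧ ∀ l : Fin N', z (Fin.natAdd (2 * k) l) ∈ Set.Ioo (0:ℝ) 1} → Set.EqOn ρ'.integrand (fun z => c * (k.factorial : ℝ) * ∏ l, (z (Fin.natAdd (2 * k) l)) ^ ((x' l : ℝ) - 1) * (1 - z (Fin.natAdd (2 * k) l)) ^ ((y' l : ℝ) - 1)) ρ'.domain → ρ.value = ρ'.value → Literature.NumberTheory.Transcendental.KZ.of ρ - Literature.NumberTheory.Transcendental.KZ.of ρ' ∈ R := by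
  intro R hR hsum N N' k x y x' y' c hx hx' hu hc ρ ρ' hd hi hd' hi' hval
  exact hK R hR hsum _ (by rw [KZ.eval_of_sub_of, hval, sub_self])

end Summit.KontsevichZagierPeriods.KontsevichZagierPeriods.Cruxes.SeriesKernel.Birth
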